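import Summits.NavierStokesRegularity.NavierStokesRegularity.Theses.AxisymmetricExtremality
import Summits.NavierStokesRegularity.NavierStokesRegularity.Theorems.AxisymmetricExtremalityPFoldToAxisymmetric
import Summits.NavierStokesRegularity.NavierStokesRegularity.Theorems.AxisymmetricExtremalityAxisymmetricKatoGlobalNoSwirlStratum
import Summits.NavierStokesRegularity.NavierStokesRegularity.Theorems.AxisymmetricExtremalityAxisymmetricKatoGlobalReduction
import Summits.NavierStokesRegularity.NavierStokesRegularity.Theorems.AxisymmetricExtremalityAxisymmetricKatoGlobalStubSereginLogSwirlOrigin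
import Summits.NavierStokesRegularity.NavierStokesRegularity.Theorems.AxisymmetricLiouvilleBoundedSwirl
import Literature.Analysis.FluidPDE.AxisymmetricReflection

/-!
# Strategist s19-g12 (independent census, family `-s`) — typed signatures for the STRATEGY CENSUS of the crux
# `AxisymmetricKatoGlobal` (stmt-NavierStokesRegularity-15453), route `AxisymmetricExtremality`

Nothing in this file is a line, a stub or a route item.  Every `theorem` is sorry-free bookkeeping over LANDED
tree results, recorded so that each heading of `STRATEGY-CENSUS-s19-g12.md` points at a kernel-checked signature:

* `## Weaker intermediate`  — `NoAxisymMinimalBlowupDatum` (W1: the ONLY instance of the crux that `closes`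
  consumes), `summit_of_W1`, `summit_iff_W1_form`, and the O(2)-symmetric instance `no_O2_minimalBlowupDatum`
  which is a THEOREM (reflection ⇒ swirl-free ⇒ landed no-swirl stratum);
* `## Decomposition`        — D1 = {W1, `AxisymThresholdTransfer`} with the assembly `crux_of_W1_transfer` proved,
  and `transfer_of_finiteThresholdForm` (D1b follows from the `ρ_max^pure < ⊤`-antecedent form of the sister cruxes);
  D4 = {AX-L, exclusion of velocity-dominated cores, inner dichotomy in the Kato class}: `crux_of_AXL_split`
  (logical shape; the typed model of the dichotomy for the smooth rapidly-decaying class is the tree's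
  `Summit.NavierStokesRegularity.OSWSelfSimilar.TypeIIModulationDictionary.certifiedBlowupAxisymBlowup_innerObject_dichotomy`);
* `## Strengthen`           — S⁺ = `LogCubedSwirlAxisModulus` (= the registered line's open stub 3, verbatim the
  hypothesis of the landed capstone), `crux_of_logCubedSwirlAxisModulus` (unconditional over the tree, since
  `seregin2022_logSwirl_regularAtOrigin` is discharged).
-/

open Set MeasureTheory Filter Topology Function
open scoped ENNReal NNReal
open Literature.Analysis.FluidPDE Literature.Analysis.FunctionSpaces

namespace Summit.NavierStokesRegularity.NavierStokesRegularity.Cruxes.AxisymmetricKatoGlobal.StrategistS19g12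

open Summit.NavierStokesRegularity.NavierStokesRegularity.Theses.AxisymmetricExtremality

/-! ## W — weaker intermediates, from the summit down -/

/-- **W1 — «no axisymmetric `Ḣ^{1/2}`-minimal blow-up datum».**  For every `ν > 0` no element of Rusin–Šverák's
set `M(ν)` (`IsMinimalBlowupDatum ν`) is axisymmetric.  This is the only instance of the crux used by `closes`. -/
def NoAxisymMinimalBlowupDatum : Prop :=
  ∀ ν : ℝ, 0 < ν → ∀ (u₀ : EuclideanSpace ℝ (Fin 3) → EuclideanSpace ℝ (Fin 3))
    (g : HomSobolev (EuclideanSpace ℝ (Fin 3)) (EuclideanSpace ℂ (Fin 3)) (1 / 2 : ℝ)),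
    IsMinimalBlowupDatum ν u₀ g → IsAxisymmetric u₀ → False

/-- The crux implies W1 (one line: a minimal blow-up datum has no global Kato solution). -/
theorem noAxisymMinimalBlowupDatum_of_crux (h : AxisymmetricKatoGlobal) : NoAxisymMinimalBlowupDatum :=
  fun ν hν u₀ g hmin hax => hmin.2.2.2.2 (h ν hν u₀ g hmin.1 hmin.2.1 hmin.2.2.1 (fun θ x => hax θ x))

/-- `closes` re-run with W1 in place of the crux: the same two lines of logic. -/
theorem summit_of_W1 (h₂ : MinimalDatumPFold) (h₄ : PFoldToAxisymmetric) (hW : NoAxisymMinimalBlowupDatum) :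
    NavierStokesRegularity := by
  show Literature.NS.NavierStokesExistenceSmoothR3
  intro ν hν u₀ hsm hdiv hdec
  by_contra hno
  obtain ⟨u₁, g, hmin, hax⟩ := h₄ ν hν (h₂ ν hν ⟨u₀, hsm, hdiv, hdec, hno⟩)
  exact hW ν hν u₁ g hmin (fun θ x => hax θ x)

/-- With the PROVED sibling crux `PFoldToAxisymmetric`, `MinimalDatumPFold ∧ W1` already gives the summit. -/
theorem summit_of_W1' (h₂ : MinimalDatumPFold) (hW : NoAxisymMinimalBlowupDatum) : NavierStokesRegularity :=
  summit_of_W1 h₂ Theorems.axisymmetricExtremality_pFoldToAxisymmetric_proof hW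

/-- Vacuity of the sister crux under the summit (its antecedent is verbatim the failure of Clay (A) at `ν`;
the landed `Theorems.MinimalDatumPFold.Negative.cruxBody_of_navierStokesRegularity`, re-proved in two lines so that
this sketch does not depend on that module). -/
theorem minimalDatumPFold_of_summit (hS : NavierStokesRegularity) : MinimalDatumPFold := by
  intro ν hν hfail
  obtain ⟨v₀, hsm, hdiv, hdec, hno⟩ := hfail
  have hS' : Literature.NS.NavierStokesExistenceSmoothR3 := hS
  exact absurd (hS' ν hν v₀ hsm hdiv hdec) hno

/-- Relative strength over the tree: `Clay (A) ↔ MinimalDatumPFold ∧ (W1 ∨ Clay (A))` — the exact analogue of the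
landed `Theorems.stub_summitIffMinimalDatumPFoldAnd` with W1 for the crux.  W1 is NOT known to follow from the
summit (it speaks about critical `Ḣ^{1/2}` data), hence the disjunct. -/
theorem summit_iff_W1_form :
    NavierStokesRegularity ↔ (MinimalDatumPFold ∧ (NoAxisymMinimalBlowupDatum ∨ NavierStokesRegularity)) :=
  ⟨fun hS => ⟨minimalDatumPFold_of_summit hS, Or.inr hS⟩, fun h => h.2.elim (summit_of_W1' h.1) id⟩

/-- **W1[O(2)] is a theorem.**  An axisymmetric minimal blow-up datum which is moreover equivariant under the
meridian reflection `reflY` is swirl-free (`IsAxisymmetric.hasNoSwirl_of_reflY_eq`), hence has a global Kato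
solution by the landed no-swirl stratum — contradicting minimality.  (This is the analytic half of the crux idea
`dihedral-smith-bypass`; recorded here because it bounds from below what a weaker intermediate can buy.) -/
theorem no_O2_minimalBlowupDatum : ∀ ν : ℝ, 0 < ν →
    ∀ (u₀ : EuclideanSpace ℝ (Fin 3) → EuclideanSpace ℝ (Fin 3))
      (g : HomSobolev (EuclideanSpace ℝ (Fin 3)) (EuclideanSpace ℂ (Fin 3)) (1 / 2 : ℝ)),
      IsMinimalBlowupDatum ν u₀ g → IsAxisymmetric u₀ → (∀ x, u₀ (reflY x) = reflY (u₀ x)) → False :=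
  fun ν hν u₀ _g hmin hax hσ => hmin.2.2.2.2
    (Theorems.AxisymmetricKatoGlobal.NoSwirlStratum.axisymmetricKatoGlobal_noSwirl_stratum ν hν u₀ hmin.1
      hmin.2.2.1 (fun θ x => hax θ x) (hax.hasNoSwirl_of_reflY_eq hσ))

/-! ## D1 — the threshold decomposition {W1, threshold transfer} -/

/-- **D1b — threshold transfer inside the axisymmetric class.**  If SOME admissible axisymmetric `Ḣ^{1/2}` datum
fails to have a global Kato solution at viscosity `ν`, then some axisymmetric datum lies in `M(ν)`. -/
def AxisymThresholdTransfer : Prop :=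
  ∀ ν : ℝ, 0 < ν →
    (∃ (u₀ : EuclideanSpace ℝ (Fin 3) → EuclideanSpace ℝ (Fin 3))
        (g : HomSobolev (EuclideanSpace ℝ (Fin 3)) (EuclideanSpace ℂ (Fin 3)) (1 / 2 : ℝ)),
        MemLp u₀ 3 volume ∧ g.Represents (Literature.Analysis.FunctionSpaces.EuclideanSpace.complexify ∘ u₀) ∧
          IsWeaklyDivFree u₀ ∧ IsAxisymmetric u₀ ∧ ¬ HasGlobalKatoSolution ν u₀) →
      ∃ (u₀ : EuclideanSpace ℝ (Fin 3) → EuclideanSpace ℝ (Fin 3))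
        (g : HomSobolev (EuclideanSpace ℝ (Fin 3)) (EuclideanSpace ℂ (Fin 3)) (1 / 2 : ℝ)),
        IsMinimalBlowupDatum ν u₀ g ∧ IsAxisymmetric u₀

/-- **D1 assembles (proved): W1 → D1b → crux.** -/
theorem crux_of_W1_transfer (hW : NoAxisymMinimalBlowupDatum) (hT : AxisymThresholdTransfer) :
    AxisymmetricKatoGlobal := by
  intro ν hν u₀ g hL3 hrep hdiv hax
  by_contra hno
  obtain ⟨u₁, g₁, hmin, hax₁⟩ := hT ν hν ⟨u₀, g, hL3, hrep, hdiv, fun θ x => hax θ x, hno⟩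
  exact hW ν hν u₁ g₁ hmin hax₁

/-- The `ρ_max^pure(ν) < ⊤`-antecedent form of «an axisymmetric minimal blow-up datum exists» (the shape of the
sister cruxes `MinimalDatumPFold ∧ PFoldToAxisymmetric` with the Clay-failure antecedent replaced by finiteness of
the pure threshold). -/
def AxisymMinimalDatumOfFiniteThreshold : Prop :=
  ∀ ν : ℝ, 0 < ν → rusinSverakRhoMaxPure ν < ⊤ →
    ∃ (u₀ : EuclideanSpace ℝ (Fin 3) → EuclideanSpace ℝ (Fin 3))
      (g : HomSobolev (EuclideanSpace ℝ (Fin 3)) (EuclideanSpace ℂ (Fin 3)) (1 / 2 : ℝ)),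
      IsMinimalBlowupDatum ν u₀ g ∧ IsAxisymmetric u₀

/-- D1b follows from the finite-threshold form: a non-global admissible datum forces `ρ_max^pure(ν) ≤ ‖g‖ < ⊤`
(contrapositive of `hasGlobalKatoSolution_of_lt_rusinSverakRhoMaxPure`). -/
theorem transfer_of_finiteThresholdForm (h : AxisymMinimalDatumOfFiniteThreshold) : AxisymThresholdTransfer := by
  rintro ν hν ⟨u₀, g, hL3, hrep, hdiv, -, hno⟩
  refine h ν hν ?_
  have hle : rusinSverakRhoMaxPure ν ≤ ‖g‖ₑ :=
    not_lt.1 fun hlt => hno (hasGlobalKatoSolution_of_lt_rusinSverakRhoMaxPure hL3 hrep hdiv hlt)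
  exact lt_of_le_of_lt hle enorm_lt_top

/-! ## D4 — the Liouville branch decomposition {AX-L, no velocity-dominated core, inner dichotomy} -/

/-- **D4 (logical shape).**  For any predicate `VelDom ν u₀` («the Kato evolution of `u₀` blows up with a
velocity-dominated (type-α) core: a gauge-normalised KNSS zoom converging to a constant field with zoomed vorticity
→ 0»), the three pieces (i) inner dichotomy in the Kato class, (ii) the named open conjecture AX-L
(`Summit.NavierStokesRegularity.NavierStokesRegularity.AxisymmetricLiouvilleBoundedSwirl`), (iii) exclusion of
type-α cores, assemble to the crux by cases.  The typed instance of (i) for the smooth rapidly-decaying Leray–Hopf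
class is the tree's `…OSWSelfSimilar.TypeIIModulationDictionary.certifiedBlowupAxisymBlowup_innerObject_dichotomy`. -/
theorem crux_of_AXL_split
    (VelDom : ℝ → (EuclideanSpace ℝ (Fin 3) → EuclideanSpace ℝ (Fin 3)) → Prop)
    (hdich : ∀ ν : ℝ, 0 < ν → ∀ (u₀ : EuclideanSpace ℝ (Fin 3) → EuclideanSpace ℝ (Fin 3))
      (g : HomSobolev (EuclideanSpace ℝ (Fin 3)) (EuclideanSpace ℂ (Fin 3)) (1 / 2 : ℝ)),
      MemLp u₀ 3 volume → g.Represents (Literature.Analysis.FunctionSpaces.EuclideanSpace.complexify ∘ u₀) →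
        IsWeaklyDivFree u₀ → IsAxisymmetric u₀ → ¬ HasGlobalKatoSolution ν u₀ →
          ¬ Summit.NavierStokesRegularity.NavierStokesRegularity.AxisymmetricLiouvilleBoundedSwirl ∨ VelDom ν u₀)
    (hAXL : Summit.NavierStokesRegularity.NavierStokesRegularity.AxisymmetricLiouvilleBoundedSwirl)
    (hα : ∀ ν : ℝ, 0 < ν → ∀ u₀, VelDom ν u₀ → False) : AxisymmetricKatoGlobal := by
  intro ν hν u₀ g hL3 hrep hdiv hax
  by_contra hno
  rcases hdich ν hν u₀ g hL3 hrep hdiv (fun θ x => hax θ x) hno with h | h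
  · exact h hAXL
  · exact hα ν hν u₀ h

/-! ## S⁺ — the strengthening actually on the table -/

/-- **S⁺ = the log-cubed modulus of the swirl at the axis** (verbatim the registered line's open stub 3
`stub_swirlAxisModulus` = the second hypothesis of the landed capstone `Registered.AxisymmetricKatoGlobal_of_logSwirlFacts`). -/
def LogCubedSwirlAxisModulus : Prop :=
  ∀ ν : ℝ, 0 < ν → ∀ T : ℝ, 0 < T → ∀ (u₀ : EuclideanSpace ℝ (Fin 3) → EuclideanSpace ℝ (Fin 3))
    (g : HomSobolev (EuclideanSpace ℝ (Fin 3)) (EuclideanSpace ℂ (Fin 3)) (1 / 2 : ℝ))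
    (u : ℝ → EuclideanSpace ℝ (Fin 3) → EuclideanSpace ℝ (Fin 3)),
    g.Represents (Literature.Analysis.FunctionSpaces.EuclideanSpace.complexify ∘ u₀) → IsKatoSolutionOn T ν u₀ u →
      ContDiffOn ℝ (⊤ : ℕ∞) (uncurry u) (Ioo 0 T ×ˢ univ) → (∀ t ∈ Ioo 0 T, IsAxisymmetric (u t)) →
        ∀ t₀ ∈ Ioo 0 T, ∃ C δ₀ : ℝ, 0 < δ₀ ∧ δ₀ < 1 ∧ ∀ t ∈ Ico t₀ T, ∀ x : EuclideanSpace ℝ (Fin 3),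
          cylRadius x ≤ δ₀ → |swirl (u t) x| ≤ C / |Real.log (cylRadius x)| ^ 3

/-- **S⁺ ⇒ crux, unconditionally over the tree** (capstone p150628 + the discharged Seregin-2022 fact). -/
theorem crux_of_logCubedSwirlAxisModulus (h : LogCubedSwirlAxisModulus) : AxisymmetricKatoGlobal :=
  Theorems.AxisymmetricKatoGlobal.Registered.AxisymmetricKatoGlobal_of_logSwirlFacts
    Theorems.AxisymmetricKatoGlobal.EulerScaling.seregin2022_logSwirl_regularAtOrigin_holds h

end Summit.NavierStokesRegularity.NavierStokesRegularity.Cruxes.AxisymmetricKatoGlobal.StrategistS19g12
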